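import Literature.NumberTheory.Rogawski1990.ArchOrbFamGExtCentralJetModel        -- ★ p851263 (this seat) J1: `exists_nhds_bddAbove_norm_iteratedFDeriv_orbFamGExt_of_centralModel`
import Literature.NumberTheory.Rogawski1990.ArchOrbFamGScalarCornerBookkeeping      -- ★ p851280 (F0P3a-p09 (g7)) (s1)(s2): `exists_contDiff_cptFactor_eq_mul_rootProduct_sub`, `conj_gprimeBlockAt_eq_conj_circleDiagonal_centre_of_scalar`
import Literature.NumberTheory.Rogawski1990.ArchOrbFamGExtSmoothInRegG             -- ★ (A5) p851150 (F0P3b-p01): `contDiffOn_orbFamGExt_inRegG` (clause (I₂) = `h1`)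
import Literature.NumberTheory.Rogawski1990.ArchOrbFamGSmoothModelParam            -- ★ (A4′): `isOpen_setOf_inRegAt`
import Literature.NumberTheory.Rogawski1990.ArchHCSmoothBoundedStrata              -- ★ (I₁-asm) ED. 2 p851201 (LH7-p04 (g4)): `eq_of_circleExp_eq_of_mem_Ico`; the `hC₀` socket this file pays
import Literature.NumberTheory.Rogawski1990.ArchOrbFamGExtCentralPartialModel        -- ★ p851294 (this seat) (J2-b): `contDiffOn_partialUnfoldedModel`, `exists_isCompact_partialUnfoldedModel_integrand_eq_zero`
import Literature.NumberTheory.Rogawski1990.ArchDeltaTransferOfChartRead            -- ★ `ne_zero_of_diagonal_anisotropic`, `complexConj_apply_eq_of_diagonal_frame`; brings `im_embedding_diagonal_eq_zero`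
import Literature.NumberTheory.Rogawski1990.ArchOrbFamGUnfoldedModelIsolateOfRegG   -- ★ (J2-a) p851352 (F0P3a-p05 (g21)): `orbFamG_eq_unfoldedModel_isolate_of_regG`
import Literature.NumberTheory.Automorphic.ArchTorusOrbitalFubiniSmooth            -- ★ `coe_archPiEquivCM_symm_assemble` (the matrix of the reassembled element)
import HarnessLib

/-!
# (B3-JUNCTION) J2 — local jet bounds of `orbFamGExt` at a compact SCALAR CORNER: the dischargers of ★ J1's central model
# (Harish-Chandra ∕ Warner II Thm. 8.4.3.1 at the scalar place; Varadarajan 1977 I §1.12; Bouaziz 1994 §3.1 (I₁); Rogawski 1990 §8.2–8.3)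

Topic `NumberTheory/Rogawski1990`; namespace `Literature.NumberTheory.Rogawski1990`.  THEOREMS ONLY (no `def`, no instance, no notation, no axiom, no named fact, no `sorry`).
Cell `pub/hodgecm-mathlib`, crux H413 (`stmt-HodgeConjecture-24833`), F0∕P3c line LH3 (closer stub `stub_N9`, DIRECT ROAD `F0_P3c_StubN9Direct`, leaf v5.1∕v6), LETTER L1 clause (I₁),
organ **O-L1d `stub_N9hcCentralJetBounds`** (`HcCentralJetBoundsStatement`, leaf :182) = the `hC₀` callback of ★ (I₁-asm) ED. 2 `smoothBounded_orbFamGExt_of_strata₄`; brick **(B3-JUNCTION) J2**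
(LH3-plan (g4) DEAL 2026-09-02T11:14:03Z, RULING 11:26:38Z «A-p12 KEEPS J2»); seat A-p12 (g28).  Count-neutral.

EDITION 1 = **(J2-c) the ISOLATED-MODEL head**: J1's central model DISCHARGED down to ONE identity `hIso` — the isolated unfolded model of the raw member `orbFamG` on the
`G`-regular set near `x` («(J2-a)», F0P3a-p05 (g21) ∕ F0P3a-p07 (g18) by name: ★ (A5a) `orbFamG_eq_unfoldedModel_of_regG` with the compact place `w` pulled out of the compact
quotient as a whole-group orbital integral) — and the two J1 binders `hΘ`∕`hΘc` of the PARTIAL model (★ (J2-b) `contDiffOn_partialUnfoldedModel` ∕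
`exists_isCompact_partialUnfoldedModel_integrand_eq_zero`, `ArchOrbFamGExtCentralPartialModel`).  What THIS head discharges by itself: the literal scalar base point (cube +
`cexp`-coincidences ⇒ `x w l` all equal, ★ `eq_of_circleExp_eq_of_mem_Ico`), the unit `u` (★ (s1) `exists_contDiff_cptFactor_eq_mul_rootProduct_sub`: the `w`-factor of Shelstad's
normaliser is «entire × `rootProduct` of the shifted relabelled angles»; the other compact factors and the constants are entire), the torus point (★ (s2)
`conj_gprimeBlockAt_eq_conj_circleDiagonal_centre_of_scalar`: `γ_w(c) = diag(ζe^{iθ(c)})`, `ζ = e^{i x_{w0}}`, `τ = lineOf (formSign α w)`), the open parameter set `O = {in-regular at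
every compact w′ ≠ w}` (★ `isOpen_setOf_inRegAt`; `x ∈ O` is the socket's `hreg′`), the chart `A = id`, `orbFamGExt = orbFamG` on `RegG` (★ `orbFamGExt_of_mem_regG`), and clause (I₂)
`h1` (★ (A5) `contDiffOn_orbFamGExt_inRegG`).  EDITION 2 will append the `L1Frame` closer `…_of_scalarCorner` (= leaf :182) once (J2-a) is ★.
HONEST LABEL: the MIXED scalar corners (organ O-L1d′ `hCm`) are NOT covered; HC_CM is proved only modulo the 7 printed citations (2 remaining: hLiu418 = `stmt-HodgeConjecture-24832`,
h413 = `stmt-HodgeConjecture-24833`) until rung 0 closes; this file moves no row of the books until EDITION 2 lands and the leaf pays `stub_N9hcCentralJetBounds` by `exact`.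

## References
* [WarnerHASSLG2] G. Warner, *Harmonic Analysis on Semi-Simple Lie Groups II*, Grundlehren 189 (1972), Thm. 8.4.3.1.
* [Varadarajan1977] V. S. Varadarajan, *Harmonic Analysis on Real Reductive Groups*, LNM 576 (1977), Part I §1.12, §3.
* [Bouaziz1994IntegralesOrbitales] A. Bouaziz, *Intégrales orbitales sur les groupes de Lie réductifs*, Ann. Sci. ÉNS 27 (1994), §3.1 (I₁)–(I₂) p. 579.
* [Rogawski1990] J. D. Rogawski, *Automorphic Representations of Unitary Groups in Three Variables*, Ann. of Math. Stud. 123 (1990), §4.9 p. 55; §8.2 p. 122; §8.3 p. 124.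
* [Shelstad1979] D. Shelstad, *Characters and inner forms of a quasi-split group over ℝ*, Compositio Math. 39 (1979), §4 pp. 22–24.
-/

set_option autoImplicit false

noncomputable section

open MeasureTheory Measure Filter Topology Set Function Metric NumberField NumberField.InfinitePlace
open Literature.NumberTheory.Automorphic Literature.NumberTheory.Automorphic.UnitaryGroup Literature.NumberTheory.Automorphic.ArchCartan
open Literature.Geometry.ComplexHyperbolic Literature.Geometry.ComplexHyperbolic.BallModel
open Literature.MeasureTheory.Group
open scoped MatrixGroups Matrix.Norms.Operator ContDiff Classical Real NNReal ENNReal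

namespace Literature.NumberTheory.Rogawski1990

/-! ## §1 (J2-c) The ISOLATED-MODEL head: J1's central model discharged down to the isolation identity `hIso` and the partial model's two binders -/

section Isolated

variable (L : Type) [Field L] [NumberField L] [IsCMField L] (α : Fin 3 → L)
  [MeasurableSpace ↥(arch (↥(maximalRealSubfield L)) L (IsCMField.complexConj L) 3 (Matrix.diagonal α))]
  [BorelSpace ↥(arch (↥(maximalRealSubfield L)) L (IsCMField.complexConj L) 3 (Matrix.diagonal α))]
  (ν' : Measure ↥(arch (↥(maximalRealSubfield L)) L (IsCMField.complexConj L) 3 (Matrix.diagonal α))) [ν'.IsHaarMeasure] [ν'.IsMulRightInvariant]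
  (S' : Finset {w : InfinitePlace L // IsComplex w})

/-- **(B3-JUNCTION) J2-c — LOCAL JET BOUNDS OF `orbFamGExt` AT A SCALAR CORNER FROM AN ISOLATED MODEL OF THE RAW MEMBER.**  Frame `hα hreal`, admissible `S′` (`hS′`), test
function `a′ ∈ C_c^∞(G′_∞)` (`ha′`, for clause (I₂) ★ (A5)); a cube point `x` (`hcube`) SCALAR at the compact place `w ∉ S′` (`hsc`: all `e^{i x_{w l}}` equal) and in-regular at every
other compact place (`hreg′`); a Haar measure `ν_w` on `U(α)_w`; a PARTIAL MODEL `Θ : V × M₃(ℂ) → ℂ`, `C^∞` on `{c | in-regular at every compact w′ ≠ w} ×ˢ univ` (`hΘ`) and vanishing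
at `(q, ↑↑k)` for `k` off ONE compact of `U(α)_w` (`hΘc`) — ★ (J2-b) supplies both for the partial unfolded model —, a constant `Kc`, and the ISOLATED MODEL IDENTITY `hIso` on
`U₀ ∩ RegG S′` (`U₀ ∈ 𝓝 x`): `orbFamG S′ c = (∏_{w′∉S′} (1−e^{i(c_{w′1}−c_{w′0})})(1−e^{i(c_{w′2}−c_{w′0})})(1−e^{i(c_{w′2}−c_{w′1})})) · Kc · ∫_{U(α)_w} Θ(c, ↑↑(g·γ_w(c w)·g⁻¹)) dν_w(g)` («(J2-a)»:
★ (A5a) with the place `w` isolated).  THEN `∃ U ∈ 𝓝 x, BddAbove (‖Dⁿ(orbFamGExt ν′ a′ S′)‖ '' (U ∩ InRegG (slotSign α) S′))`.  Proof = ★ J1 `…_of_centralModel` at `A := id`,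
`O := {in-regular at every compact w′ ≠ w}` (★ `isOpen_setOf_inRegAt`, `x ∈ O` by `hreg′`), `ζ := e^{i x_{w0}}`, `τ := lineOf (formSign α w)`, with `hxw` from `hcube`+`hsc` (★
`eq_of_circleExp_eq_of_mem_Ico`), `u := (∏_{w′≠w} cpt factors) · Kc · v` (★ (s1)), the torus point by ★ (s2), `orbFamGExt = orbFamG` on `RegG` (★ `orbFamGExt_of_mem_regG`) and
`h1` := ★ (A5) `contDiffOn_orbFamGExt_inRegG`. [cite: WarnerHASSLG2, Thm. 8.4.3.1] [cite: Varadarajan1977, Part I §1.12] [cite: Bouaziz1994IntegralesOrbitales, §3.1 (I₁)–(I₂) p. 579]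
[cite: Rogawski1990, §8.2 p. 122; §8.3 p. 124] [cite: Shelstad1979, §4 pp. 22–24] -/
theorem exists_nhds_bddAbove_norm_iteratedFDeriv_orbFamGExt_of_isolatedModel (hα : ∀ i, α i ≠ 0)
    (hreal : ∀ (w : {w : InfinitePlace L // IsComplex w}) (i : Fin 3), (w.1.embedding (α i)).im = 0) (hS' : ∀ w, w ∈ S' → w ∈ splitChartPlaces L α)
    {a' : ↥(arch (↥(maximalRealSubfield L)) L (IsCMField.complexConj L) 3 (Matrix.diagonal α)) → ℂ} (ha' : ArchSmooth L 3 (Matrix.diagonal α) a') (n : ℕ)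
    {x : {w : InfinitePlace L // IsComplex w} → Fin 3 → ℝ} (hcube : ∀ w' : {w : InfinitePlace L // IsComplex w}, w' ∉ S' → ∀ l : Fin 3, x w' l ∈ Ico 0 (2 * π))
    {w : {w : InfinitePlace L // IsComplex w}} (hw : w ∉ S') (hsc : ∀ l l' : Fin 3, Circle.exp (x w l) = Circle.exp (x w l'))
    (hreg' : ∀ w' : {w : InfinitePlace L // IsComplex w}, w' ∉ S' → w' ≠ w → ∀ i j : Fin 3, i ≠ j → slotSign L α w' i ≠ slotSign L α w' j →
      Circle.exp (x w' i) ≠ Circle.exp (x w' j))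
    [MeasurableSpace (archLocal L 3 (Matrix.diagonal α) w)] [BorelSpace (archLocal L 3 (Matrix.diagonal α) w)]
    (νw : Measure (archLocal L 3 (Matrix.diagonal α) w)) [νw.IsHaarMeasure] [νw.IsMulRightInvariant]
    (Θ : ({w : InfinitePlace L // IsComplex w} → Fin 3 → ℝ) × Matrix (Fin 3) (Fin 3) ℂ → ℂ)
    (hΘ : ContDiffOn ℝ ∞ Θ ({c : {w : InfinitePlace L // IsComplex w} → Fin 3 → ℝ |
        ∀ (i : {w' : {w : InfinitePlace L // IsComplex w} // w' ∉ S' ∧ w' ≠ w}) (a b : Fin 3), a ≠ b →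
          slotSign L α i.1 a ≠ slotSign L α i.1 b → Circle.exp (c i.1 a) ≠ Circle.exp (c i.1 b)} ×ˢ (univ : Set (Matrix (Fin 3) (Fin 3) ℂ))))
    (hΘc : ∃ C : Set (archLocal L 3 (Matrix.diagonal α) w), IsCompact C ∧
      ∀ (q : {w : InfinitePlace L // IsComplex w} → Fin 3 → ℝ) (k : archLocal L 3 (Matrix.diagonal α) w), k ∉ C → Θ (q, ((k : GL (Fin 3) ℂ) : Matrix (Fin 3) (Fin 3) ℂ)) = 0)
    {U₀ : Set ({w : InfinitePlace L // IsComplex w} → Fin 3 → ℝ)} (hU₀ : U₀ ∈ 𝓝 x) (Kc : ℂ)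
    (hIso : ∀ c ∈ U₀ ∩ RegG S', orbFamG L α ν' a' S' c =
      (∏ w' ∈ Finset.univ.filter (fun w' : {w : InfinitePlace L // IsComplex w} => w' ∉ S'),
          ((1 - (Circle.exp (c w' 1 - c w' 0) : ℂ)) * (1 - (Circle.exp (c w' 2 - c w' 0) : ℂ)) * (1 - (Circle.exp (c w' 2 - c w' 1) : ℂ)))) * Kc *
        ∫ g : archLocal L 3 (Matrix.diagonal α) w, Θ (c, (((g * gprimeBlockAt L α w S' (c w) * g⁻¹ : archLocal L 3 (Matrix.diagonal α) w) : GL (Fin 3) ℂ) :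
          Matrix (Fin 3) (Fin 3) ℂ)) ∂νw) :
    ∃ U ∈ 𝓝 x, BddAbove ((fun c => ‖iteratedFDeriv ℝ n (orbFamGExt L α ν' a' S') c‖) '' (U ∩ InRegG (slotSign L α) S')) := by
  -- the base point is LITERALLY scalar at `w`
  have hxw : ∀ l l' : Fin 3, x w l = x w l' := fun l l' => eq_of_circleExp_eq_of_mem_Ico (hsc l l') (hcube w hw l) (hcube w hw l')
  -- ★ (s1): the `w`-factor of the normaliser = entire × rootProduct of the shifted relabelled angles
  obtain ⟨v, hv, hvfac⟩ := exists_contDiff_cptFactor_eq_mul_rootProduct_sub w (lineOf (formSign L α w)) x hxw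
  -- the open parameter set `O ∋ x`
  have hO : IsOpen {c : {w : InfinitePlace L // IsComplex w} → Fin 3 → ℝ |
      ∀ (i : {w' : {w : InfinitePlace L // IsComplex w} // w' ∉ S' ∧ w' ≠ w}) (a b : Fin 3), a ≠ b →
        slotSign L α i.1 a ≠ slotSign L α i.1 b → Circle.exp (c i.1 a) ≠ Circle.exp (c i.1 b)} :=
    isOpen_setOf_inRegAt L α (fun i : {w' : {w : InfinitePlace L // IsComplex w} // w' ∉ S' ∧ w' ≠ w} => i.1)
  have hxO : x ∈ {c : {w : InfinitePlace L // IsComplex w} → Fin 3 → ℝ |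
      ∀ (i : {w' : {w : InfinitePlace L // IsComplex w} // w' ∉ S' ∧ w' ≠ w}) (a b : Fin 3), a ≠ b →
        slotSign L α i.1 a ≠ slotSign L α i.1 b → Circle.exp (c i.1 a) ≠ Circle.exp (c i.1 b)} :=
    fun i a b hab hs => hreg' i.1 i.2.1 i.2.2 a b hab hs
  obtain ⟨C, hC, hΘC⟩ := hΘc
  -- the unit: the other compact factors, the constant, and (s1)'s entire factor
  have hfactor : ∀ w' : {w : InfinitePlace L // IsComplex w}, ContDiff ℝ ∞ fun c : {w : InfinitePlace L // IsComplex w} → Fin 3 → ℝ =>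
      (1 - (Circle.exp (c w' 1 - c w' 0) : ℂ)) * (1 - (Circle.exp (c w' 2 - c w' 0) : ℂ)) * (1 - (Circle.exp (c w' 2 - c w' 1) : ℂ)) := by
    intro w'
    have he : ∀ i j : Fin 3, ContDiff ℝ ∞ fun c : {w : InfinitePlace L // IsComplex w} → Fin 3 → ℝ => (Circle.exp (c w' j - c w' i) : ℂ) := by
      intro i j
      have h : (fun c : {w : InfinitePlace L // IsComplex w} → Fin 3 → ℝ => (Circle.exp (c w' j - c w' i) : ℂ)) =
          fun c => Complex.exp (((c w' j - c w' i : ℝ) : ℂ) * Complex.I) := funext fun c => Circle.coe_exp _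
      rw [h]
      exact Complex.contDiff_exp.comp ((Complex.ofRealCLM.contDiff.comp ((contDiff_apply_apply ℝ ℝ w' j).sub (contDiff_apply_apply ℝ ℝ w' i))).mul contDiff_const)
    exact ((contDiff_const.sub (he 0 1)).mul (contDiff_const.sub (he 0 2))).mul (contDiff_const.sub (he 1 2))
  obtain ⟨u, hudef⟩ : ∃ u : ({w : InfinitePlace L // IsComplex w} → Fin 3 → ℝ) → ℂ, u = fun c =>
      (∏ w' ∈ (Finset.univ.filter (fun w' : {w : InfinitePlace L // IsComplex w} => w' ∉ S')).erase w,
          ((1 - (Circle.exp (c w' 1 - c w' 0) : ℂ)) * (1 - (Circle.exp (c w' 2 - c w' 0) : ℂ)) * (1 - (Circle.exp (c w' 2 - c w' 1) : ℂ)))) * Kc * v c := ⟨_, rfl⟩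
  have hu : ContDiff ℝ ∞ u := by
    rw [hudef]
    exact ((contDiff_prod fun w' _ => hfactor w').mul contDiff_const).mul hv
  have hwmem : w ∈ Finset.univ.filter (fun w' : {w : InfinitePlace L // IsComplex w} => w' ∉ S') := Finset.mem_filter.2 ⟨Finset.mem_univ _, hw⟩
  -- ★ J1 at `A := id`, `O := {in-regular at every compact w′ ≠ w}`, `ζ := e^{i x_{w0}}`, `τ := lineOf (formSign α w)`
  refine exists_nhds_bddAbove_norm_iteratedFDeriv_orbFamGExt_of_centralModel L α ν' a' S' hα hw (hreal w) hxw (Circle.exp (x w 0)) (lineOf (formSign L α w))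
    (ContinuousLinearMap.id ℝ ({w : InfinitePlace L // IsComplex w} → Fin 3 → ℝ)) (inter_mem hU₀ (hO.mem_nhds hxO)) hO (fun c hc => hc.2) νw Θ hΘ
    ⟨C, hC, fun q _ k hk => hΘC q k hk⟩ u hu.contDiffOn ?_ (contDiffOn_orbFamGExt_inRegG L α ν' S' hα hreal hS' ha') n
  -- the central model identity on `U ∩ RegG S′`
  rintro c ⟨⟨hcU₀, -⟩, hcreg⟩
  have hint : ∫ g : archLocal L 3 (Matrix.diagonal α) w, Θ (c, (((g * gprimeBlockAt L α w S' (c w) * g⁻¹ : archLocal L 3 (Matrix.diagonal α) w) : GL (Fin 3) ℂ) :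
        Matrix (Fin 3) (Fin 3) ℂ)) ∂νw =
      ∫ g : archLocal L 3 (Matrix.diagonal α) w, Θ (c, (((g * ⟨circleDiagonal 3 (fun k => Circle.exp (x w 0) *
        Circle.exp (c w ((lineOf (formSign L α w)).symm k) - x w ((lineOf (formSign L α w)).symm k))), circleDiagonal_mem_archLocal_diagonal L 3 α w _⟩ * g⁻¹ :
          archLocal L 3 (Matrix.diagonal α) w) : GL (Fin 3) ℂ) : Matrix (Fin 3) (Fin 3) ℂ)) ∂νw := by
    refine integral_congr_ae (Eventually.of_forall fun g => ?_)
    simp only []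
    rw [conj_gprimeBlockAt_eq_conj_circleDiagonal_centre_of_scalar L α w S' hw hxw c g]
  rw [orbFamGExt_of_mem_regG L α ν' a' S' hcreg, hIso c ⟨hcU₀, hcreg⟩, ← Finset.mul_prod_erase _ _ hwmem, hvfac c, hint, hudef,
    ContinuousLinearMap.coe_id', id_eq]
  ring

end Isolated

/-! ## §2 EDITION 2 — the `L1Frame` CLOSER `…_of_scalarCorner` (= leaf :182 `HcCentralJetBoundsStatement`): all data discharged, (J2-a) the one input -/

section Closer

open Literature.NumberTheory.GaloisRepresentations Literature.MeasureTheory.Group Complex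

variable (L : Type) [Field L] [NumberField L] [IsCMField L] (α : Fin 3 → L)
  [MeasurableSpace ↥(arch (↥(maximalRealSubfield L)) L (IsCMField.complexConj L) 3 (Matrix.diagonal α))]
  [BorelSpace ↥(arch (↥(maximalRealSubfield L)) L (IsCMField.complexConj L) 3 (Matrix.diagonal α))]
  (ν' : Measure ↥(arch (↥(maximalRealSubfield L)) L (IsCMField.complexConj L) 3 (Matrix.diagonal α))) [ν'.IsHaarMeasure] [ν'.IsMulRightInvariant]

/-- **(B3-JUNCTION) J2 CLOSER — (I₁) AT THE PURE SCALAR CORNERS, `L1Frame` FORM** (leaf `F0_P3c_StubN9Direct` :182 `HcCentralJetBoundsStatement` after its frame prefix, token for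
token: the diagonal frame's hermitian-reality and anisotropy guards, a test function `a′ ∈ C_c^∞(G′_∞)`, a chart label `S′`, an order `n`, a cube point `x` with a SCALAR CORNER at
ONE compact indefinite place `w ∉ S′` and no noncompact coincidence at any other compact place).  CONCLUSION: every jet of `orbFamGExt ν′ a′ S′` is bounded near `x` on `InRegG` —
Harish-Chandra's local boundedness of the normalised invariant integral at central points of `U(2,1)_w`, IN HOUSE: ★ J1 (HC's bound ★ (B3-ENGINE) at `w` + J1-core) through §1
`…_of_isolatedModel`, with ★ (J2-b)'s partial unfolded model and the isolation identity ★ (J2-a) `orbFamG_eq_unfoldedModel_isolate…` (F0P3a-p05 (g21)); the (A5a) data are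
discharged exactly as in ★ (A5) `contDiffOn_orbFamGExt_inRegG` (product reading of `ν′`, chart tori Haar measures, the standard split group's `K`, `κ`, `μ_N`, boost torus, split
frames, Iwasawa constants) plus the compact-place-`≠ w` torus product's Haar measure; junk labels (`S′ ⊄ splitChartPlaces`) carry the zero family (★ `orbFamGExt_of_not_admissible`).
[cite: WarnerHASSLG2, Thm. 8.4.3.1] [cite: Varadarajan1977, Part I §1.12; §3] [cite: Bouaziz1994IntegralesOrbitales, §3.1 (I₁) p. 579] [cite: Rogawski1990, §8.2 p. 122; §8.3 p. 124] -/
theorem exists_nhds_bddAbove_norm_iteratedFDeriv_orbFamGExt_of_scalarCorner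
    (hherm : ((Matrix.diagonal α).map (cmConjRingHom L)).transpose = Matrix.diagonal α)
    (hanis : ∀ x : Fin 3 → L, Literature.AlgebraicGeometry.ShimuraVarieties.hermForm (cmConjRingHom L) (Matrix.diagonal α) x x = 0 → x = 0)
    (a' : ↥(arch (↥(maximalRealSubfield L)) L (IsCMField.complexConj L) 3 (Matrix.diagonal α)) → ℂ) (ha' : ArchSmooth L 3 (Matrix.diagonal α) a')
    (S' : Finset {w : InfinitePlace L // IsComplex w}) (n : ℕ) (x : {w : InfinitePlace L // IsComplex w} → Fin 3 → ℝ)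
    (hcube : ∀ w' : {w : InfinitePlace L // IsComplex w}, w' ∉ S' → ∀ l : Fin 3, x w' l ∈ Set.Ico 0 (2 * Real.pi))
    (hsc : ∃ w : {w : InfinitePlace L // IsComplex w}, w ∉ S' ∧ (∃ i j : Fin 3, i ≠ j ∧ slotSign L α w i ≠ slotSign L α w j) ∧
      (∀ l l' : Fin 3, Circle.exp (x w l) = Circle.exp (x w l')) ∧
      ∀ w', w' ∉ S' → w' ≠ w → ∀ i' j' : Fin 3, i' ≠ j' → slotSign L α w' i' ≠ slotSign L α w' j' → Circle.exp (x w' i') ≠ Circle.exp (x w' j')) :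
    ∃ U ∈ nhds x, BddAbove ((fun c => ‖iteratedFDeriv ℝ n (orbFamGExt L α ν' a' S') c‖) '' (U ∩ InRegG (slotSign L α) S')) := by
  classical
  -- junk labels: the family is identically zero
  by_cases hS' : ∀ w, w ∈ S' → w ∈ splitChartPlaces L α
  swap
  · refine ⟨univ, univ_mem, 0, ?_⟩
    rintro _ ⟨c, -, rfl⟩
    have h0 : orbFamGExt L α ν' a' S' = fun _ => 0 := orbFamGExt_of_not_admissible L α ν' a' S' hS'
    simp only [h0, iteratedFDeriv_fun_zero, Pi.zero_apply, norm_zero, le_refl]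
  obtain ⟨w, hw, -, hscw, hreg'⟩ := hsc
  have hα : ∀ i, α i ≠ 0 := ne_zero_of_diagonal_anisotropic hanis
  have hreal : ∀ (w' : {w : InfinitePlace L // IsComplex w}) (i : Fin 3), (w'.1.embedding (α i)).im = 0 := fun w' i =>
    im_embedding_diagonal_eq_zero L 3 α (complexConj_apply_eq_of_diagonal_frame hherm) w' i
  /- (0) Borel structures on the local groups, the chart quotients, the compact-place-`≠ w` quotient -/
  letI : ∀ v : {w : InfinitePlace L // IsComplex w}, MeasurableSpace ↥(archLocal L 3 (Matrix.diagonal α) v) := fun v => borel _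
  haveI : ∀ v : {w : InfinitePlace L // IsComplex w}, BorelSpace ↥(archLocal L 3 (Matrix.diagonal α) v) := fun v => ⟨rfl⟩
  haveI : ∀ v : {w : InfinitePlace L // IsComplex w}, LocallyCompactSpace ↥(archLocal L 3 (Matrix.diagonal α) v) := fun v => locallyCompactSpace_archLocal_three L α v
  haveI : ∀ v : {w : InfinitePlace L // IsComplex w}, SecondCountableTopology ↥(archLocal L 3 (Matrix.diagonal α) v) := fun v => secondCountableTopology_archLocal_three L α v
  letI : ∀ v : {w : InfinitePlace L // IsComplex w}, MeasurableSpace (↥(archLocal L 3 (Matrix.diagonal α) v) ⧸ chartTorusGLoc L α v S') := fun v => borel _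
  haveI : ∀ v : {w : InfinitePlace L // IsComplex w}, BorelSpace (↥(archLocal L 3 (Matrix.diagonal α) v) ⧸ chartTorusGLoc L α v S') := fun v => ⟨rfl⟩
  letI : MeasurableSpace ((∀ i : {w' : {w : InfinitePlace L // IsComplex w} // w' ∉ S' ∧ w' ≠ w}, ↥(archLocal L 3 (Matrix.diagonal α) i.1)) ⧸
      Subgroup.pi Set.univ (fun i : {w' : {w : InfinitePlace L // IsComplex w} // w' ∉ S' ∧ w' ≠ w} => chartTorusGLoc L α i.1 S')) := borel _
  haveI : BorelSpace ((∀ i : {w' : {w : InfinitePlace L // IsComplex w} // w' ∉ S' ∧ w' ≠ w}, ↥(archLocal L 3 (Matrix.diagonal α) i.1)) ⧸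
      Subgroup.pi Set.univ (fun i : {w' : {w : InfinitePlace L // IsComplex w} // w' ∉ S' ∧ w' ≠ w} => chartTorusGLoc L α i.1 S')) := ⟨rfl⟩
  /- (1) the product reading of `ν′`; unimodularity -/
  obtain ⟨ν'w, hν'w, hν⟩ := exists_isHaarMeasure_eq_map_archPiEquivCM_symm_pi L 3 α ν'
  haveI : ∀ v, (ν'w v).IsHaarMeasure := hν'w
  haveI : ∀ v, (ν'w v).IsMulRightInvariant := fun v => isMulRightInvariant_of_isHaarMeasure_archLocal_diagonal_of_im_eq_zero L α hα v (hreal v) (ν'w v)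
  /- (2) torus Haar measures: local `chartHaarGLoc` and `ρ_ι` on the product of the chart tori at the compact places `≠ w` -/
  haveI : ∀ v : {w : InfinitePlace L // IsComplex w}, (chartHaarGLoc L α v S').IsHaarMeasure := fun v => isHaarMeasure_chartHaarGLoc L α v S'
  haveI : ∀ v : {w : InfinitePlace L // IsComplex w}, (chartHaarGLoc L α v S').IsInvInvariant := fun v => isInvInvariant_chartHaarGLoc L α v S'
  haveI : ∀ v : {w : InfinitePlace L // IsComplex w}, SigmaFinite (chartHaarGLoc L α v S') := fun v => sigmaFinite_chartHaarGLoc L α v S'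
  obtain ⟨ρι, hρι1, hρι2, hρι⟩ := exists_haar_map_subgroupPiCoords_eq_pi
    (fun i : {w' : {w : InfinitePlace L // IsComplex w} // w' ∉ S' ∧ w' ≠ w} => chartTorusGLoc L α i.1 S') (fun i => isClosed_chartTorusGLoc L α i.1 S')
    (fun i : {w' : {w : InfinitePlace L // IsComplex w} // w' ∉ S' ∧ w' ≠ w} => chartHaarGLoc L α i.1 S')
  haveI := hρι1
  haveI := hρι2
  /- (3) the standard split group `U(J₃)(ℂ)`: `K`, `κ`, `μ_N`, the boost torus family `τ` -/
  obtain ⟨J, hJ⟩ : ∃ J : Matrix (Fin 3) (Fin 3) ℂ, J = (StdForm.antidiagonal 3).over ℂ := ⟨_, rfl⟩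
  letI : MeasurableSpace ↥(unitaryGroupOfForm (starRingEnd ℂ) J) := borel _
  haveI : BorelSpace ↥(unitaryGroupOfForm (starRingEnd ℂ) J) := ⟨rfl⟩
  letI : MeasurableSpace (↥(unitaryGroupOfForm (starRingEnd ℂ) J) ⧸ torusU (starRingEnd ℂ) J) := borel _
  haveI : BorelSpace (↥(unitaryGroupOfForm (starRingEnd ℂ) J) ⧸ torusU (starRingEnd ℂ) J) := ⟨rfl⟩
  haveI : LocallyCompactSpace ↥(unitaryGroupOfForm (starRingEnd ℂ) J) := locallyCompactSpace_unitaryGroupOfForm_complex J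
  haveI : SecondCountableTopology ↥(unitaryGroupOfForm (starRingEnd ℂ) J) := secondCountableTopology_unitaryGroupOfForm_complex J
  obtain ⟨K, hK, -, hKB⟩ := exists_isCompact_subgroup_unitary_mul_borelU hJ
  haveI : CompactSpace ↥K := isCompact_iff_compactSpace.mp hK
  haveI : LocallyCompactSpace ↥K := hK.isClosed.isClosedEmbedding_subtypeVal.locallyCompactSpace
  obtain ⟨κ, hκ⟩ : ∃ κ : Measure ↥K, κ.IsHaarMeasure := ⟨Measure.haar, inferInstance⟩
  haveI := hκ
  have hN : IsClosed (unipotentU (starRingEnd ℂ) J : Set ↥(unitaryGroupOfForm (starRingEnd ℂ) J)) := LineRing.isClosed_unipotentU _ _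
  haveI : LocallyCompactSpace ↥(unipotentU (starRingEnd ℂ) J) := hN.isClosedEmbedding_subtypeVal.locallyCompactSpace
  obtain ⟨μN, hμN⟩ : ∃ μN : Measure ↥(unipotentU (starRingEnd ℂ) J), μN.IsHaarMeasure := ⟨Measure.haar, inferInstance⟩
  haveI := hμN
  obtain ⟨τ, hτT, hτcoe, hτmul, hτd⟩ := exists_torusU_boostEig_family hJ
  /- (4) the split frames `φ_v`, their matrices `T_v`, the Iwasawa constants `C_v` -/
  choose φ hφ hT hφT using fun v : ↥S' => exists_continuousMulEquiv_archLocal_splitChart_torusU L α v.1 hα (hS' _ v.2) hJ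
  choose T hT using hT
  have hφT' : ∀ (v : ↥S') (g : ↥(archLocal L 3 (Matrix.diagonal α) v.1)), (φ v).toMulEquiv g ∈ torusU (starRingEnd ℂ) J ↔ g ∈ chartTorusGLoc L α v.1 S' :=
    fun v g => hφT v S' hS' v.2 g
  have hφd : ∀ (v : ↥S') (cw : Fin 3 → ℝ), glDiagonal 3 ℂ (fun i => Units.mk0 (boostEig cw i) (boostEig_ne_zero cw i)) =
      ((φ v (gprimeBlockAt L α v.1 S' cw) : ↥(unitaryGroupOfForm (starRingEnd ℂ) J)) : GL (Fin 3) ℂ) := fun v cw => (hφ v S' (fun _ => cw) v.2).2.1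
  have hC : ∀ v : ↥S', ∃ C : NNReal, 0 < C ∧
      (quotientMeasure (chartTorusGLoc L α v.1 S') (chartHaarGLoc L α v.1 S') (isClosed_chartTorusGLoc L α v.1 S') (ν'w v.1)).map
          (cosetCongr (φ v).toMulEquiv (chartTorusGLoc L α v.1 S') (torusU (starRingEnd ℂ) J) (hφT' v)) = C • Measure.map
        (fun p : ↥K × ↥(unipotentU (starRingEnd ℂ) J) =>
          (QuotientGroup.mk ((p.1 : ↥(unitaryGroupOfForm (starRingEnd ℂ) J)) * (p.2 : ↥(unitaryGroupOfForm (starRingEnd ℂ) J))) :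
            ↥(unitaryGroupOfForm (starRingEnd ℂ) J) ⧸ torusU (starRingEnd ℂ) J))
        (κ.prod μN) := fun v => by
    haveI := smulInvariantMeasure_quotientMeasure (chartTorusGLoc L α v.1 S') (chartHaarGLoc L α v.1 S') (isClosed_chartTorusGLoc L α v.1 S') (ν'w v.1)
    exact exists_map_cosetCongr_eq_smul_map_of_frame hJ (chartTorusGLoc L α v.1 S') (φ v) (hφT' v) hK hKB κ μN _
      (quotientMeasure_ne_zero (chartTorusGLoc L α v.1 S') (chartHaarGLoc L α v.1 S') (isClosed_chartTorusGLoc L α v.1 S') (ν'w v.1))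
  choose C _ hμC using hC
  /- (5) the ambient lift of `a′` -/
  obtain ⟨φa, hφa, hφac, -, hφaf⟩ := ha'.exists_contDiff
  /- (6) the partial unfolded model at `w`: its two J1 binders (★ (J2-b)) -/
  haveI : IsFiniteMeasureOnCompacts (Measure.pi fun _ : ↥S' => κ.prod μN) := inferInstance
  have hΘ := contDiffOn_partialUnfoldedModel L α S' w hα hreal hS'
    (quotientMeasure (Subgroup.pi Set.univ (fun i : {w' : {w : InfinitePlace L // IsComplex w} // w' ∉ S' ∧ w' ≠ w} => chartTorusGLoc L α i.1 S')) ρι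
      (isClosed_coe_pi _ fun i => isClosed_chartTorusGLoc L α i.1 S')
      (Measure.pi fun i : {w' : {w : InfinitePlace L // IsComplex w} // w' ∉ S' ∧ w' ≠ w} => ν'w i.1))
    hJ K hK (Measure.pi fun _ : ↥S' => κ.prod μN) τ hτcoe T φa hφa hφac
  obtain ⟨Cw, hCw, hzero⟩ := exists_isCompact_partialUnfoldedModel_integrand_eq_zero L α S' w hα hw T φa hφac
  /- (7) §1 with `Θ :=` the partial unfolded model (read off `hΘ`), `hΘc` from `hzero`, and the isolation identity (★ (J2-a)) as `hIso` -/
  refine exists_nhds_bddAbove_norm_iteratedFDeriv_orbFamGExt_of_isolatedModel L α ν' S' hα hreal hS' ha' n hcube hw hscw hreg' (ν'w w) _ hΘ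
    ⟨Cw, hCw, fun q k hk => ?_⟩ univ_mem
    ((∏ w' : {w' : {w : InfinitePlace L // IsComplex w} // ¬ w' = w}, ((chartHaarGLoc L α w'.1 S' (chartBoxImgGLoc L α w'.1 S')).toReal : ℂ)) *
      ((∏ v : ↥S', (C v : ℝ) : ℝ) : ℂ)) (fun c hc => ?_)
  · -- the integrand vanishes identically off `Cw`
    refine integral_eq_zero_of_ae (Filter.Eventually.of_forall fun p => ?_)
    obtain ⟨y, η⟩ := p
    induction y using QuotientGroup.induction_on with
    | H g =>
      dsimp only
      rw [descConj_mk]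
      exact hzero k hk (fun j : ↥S' => (((((η j).1 : ↥(unitaryGroupOfForm (starRingEnd ℂ) J)) *
          (τ ![0, q j.1 1, q j.1 2] * τ ![q j.1 0 / 2, 0, 0] * ((η j).2 : ↥(unitaryGroupOfForm (starRingEnd ℂ) J)) * τ ![q j.1 0 / 2, 0, 0]) *
          ((η j).1 : ↥(unitaryGroupOfForm (starRingEnd ℂ) J))⁻¹ : ↥(unitaryGroupOfForm (starRingEnd ℂ) J)) : GL (Fin 3) ℂ) : Matrix (Fin 3) (Fin 3) ℂ))
        (g * (fun i : {w' : {w : InfinitePlace L // IsComplex w} // w' ∉ S' ∧ w' ≠ w} => gprimeBlock L α i.1 S' q) * g⁻¹)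
  · -- the isolation identity (★ (J2-a), F0P3a-p05 (g21)), read in matrix currency
    have hsymm : ∀ (v : ↥S') (u : ↥(unitaryGroupOfForm (starRingEnd ℂ) J)),
        (((φ v).symm u : ↥(archLocal L 3 (Matrix.diagonal α) v.1)) : GL (Fin 3) ℂ) = (T v)⁻¹ * (u : GL (Fin 3) ℂ) * T v := fun v u => by
      have h := hT v ((φ v).symm u)
      rw [ContinuousMulEquiv.apply_symm_apply] at h
      rw [h]
      group
    rw [orbFamG_eq_unfoldedModel_isolate_of_regG L α S' ν'w ν' hν (fun v => chartHaarGLoc L α v S') hJ φ hφT' hφd κ μN hμC τ hτT hτcoe hτmul hτd w ρι hρι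
      hα hS' hw ha'.continuous ha'.hasCompactSupport hc.2]
    conv_lhs => rw [mul_assoc, mul_assoc]
    conv_rhs => rw [mul_assoc, mul_assoc]
    congr 1
    congr 1
    congr 1
    refine integral_congr_ae (Filter.Eventually.of_forall fun x => ?_)
    dsimp only
    refine integral_congr_ae (Filter.Eventually.of_forall fun p => ?_)
    obtain ⟨y, η⟩ := p
    induction y using QuotientGroup.induction_on with
    | H g =>
      dsimp only
      rw [descConj_mk, descConj_mk, hφaf, coe_archPiEquivCM_symm_assemble]
      congr 1
      refine Matrix.ext fun a b => Prod.ext rfl (funext fun w₁ => ?_)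
      simp only [Matrix.of_apply]
      split_ifs <;> first
        | rfl
        | (exfalso; exact hw (‹w₁ = w› ▸ ‹w₁ ∈ S'›))
        | (rw [hsymm, Units.val_mul, Units.val_mul])

end Closer

end Literature.NumberTheory.Rogawski1990

end
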